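import Summits.QuantumFields.BalabanUV.Beta.SymCorrectorMixedGauge

/-!
# `BalabanUV.Beta.SymCorrectorMixedSiteGauge` — road «BF-x», binder row D1, slot (K) ∕ junction (J1), brick TT19: **THE MIXED WORD OF THE CHART
# TRANSPORT UNDER THE SITE-LAW-SHAPED MIXED SLOT LETTER** — TT13 `SymCorrectorMixedGauge`'s twin when the field-slot divergence of the
# field–multiplier table is a LEFT multiplication plus an ANCHOR term (the shape of an1's exact site law `SymMixedWardSiteLaw.symSiteWardM` for the
# literal's `symMixFFAt`), NOT the commutator `ξ • conjV (M ρ w) (diagK (legInd ϱ u′))` of TT13's `hM` (which the literal's ff-only multiplier table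
# cannot satisfy: the anchor indicator has no multiplier leg to sit on — leaf-03 g31 N-g31-1).

THE LETTER (HYPOTHESIS, pointwise, ONE root `ϱ`, scalar `ξ′`):
`hMs : ∀ ρ w u′, divV (κ u ↦ M₂ κ u ρ w) u′ = ξ′ • ((if u′ = (n:ℤ) • w + ϱ then 1 else 0) • M ρ w − comp (diagK (legInd ϱ u′)) (M ρ w))`
(the multiplier slot `(ρ, w)` is rotated at its ROOT `n•w + ϱ`; the field legs of `M ρ w` on the row side only).
* §1 letter-free bookkeeping: block sums of the two letter terms; the multiplier-column vertex of a LEFT-multiplied family (`vertexOfM_comp_diagK_fixed`);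
  the chain-rule vertex of a block-LEFT family is the LEFT multiplication by the dressed block symbol (`vertexOfK_blockLeft_eq_comp`, the left twin
  of TT10 `vertexOfK_blockContact_eq_conjV`); hence `mixOfK` of the block-left family (`mixOfK_blockLeft_eq`).
* §2 under `hMs`: the face sum ∕ face family ∕ slot transport of `M₂` = ANCHOR piece − LEFT piece.
* §3 ASSEMBLED: **`mixOfK (Ψ̂∘K∘Ψ̂ᵀ) n M₂ μ y ν y′ = mixOfK K n M₂ μ y ν y′ + mixOfK K n A μ y ν y′ − comp (Θ′ μ y) (vertexOfM K n M ν y′)`**,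
  `A κ u ρ w := (if blk n (n•w + ϱ) = blk n u then ξ′·faceWt r n κ u else 0) • M ρ w` (the ANCHOR word: block-local rescaled multiplier tables),
  `Θ′ μ y := diagK (z b ↦ Σ_α Σ_{x ∈ blockSitesF n (blk n (legSite ϱ z b))} colH K n μ y α x·(ξ′·faceWt r n α x))` (TT10's face symbol with `ξ′`).
  Bookkeeping for the HEAD (zero weight here; TT20): `−Θ′∘V_M = ½•conjV V_M Θ′ − ½•(Θ′∘V_M + V_M∘Θ′)`; the anticommutator and the anchor word are the
  pieces to test for tadpole-nullity by row parity; the commutator half is TT13's word at `ξm = ξ′∕2`.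

HONEST DEPENDENCY (cell records, verbatim): «continuum YM on T⁴ ⇐ BetaPertH ∧ nine spine estimates (0/9 proved); BetaPertH ⇐ (D1) ∧ (D4) ∧
CAP+tail; G-an2-4 gates asym, D1 and NE2/3/4.»  HONEST FRAMING (cell contract, verbatim): «discharging `BetaPertH` makes Bałaban's UV stability
UNCONDITIONAL — a real constructive-QFT result; it is NOT the continuum limit and NOT the Clay problem.»  THIS MODULE is [folklore] bookkeeping BY NAME over
TT6 `SymCorrectorRest.mixOfK_conj_psiKS`, TT7∕TT10 (`faceSum_eq_blockSum_divV`, `sum_blockSitesF_legInd`, `sum_blockSitesF_ite_eq`), TT13 (`faceSumFM_apply`), an2's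
`SecondOrderResponse` ∕ `DiagonalContact`, leaf-05's `mixOfK_add_of_bdd`; the letter `hMs` is a HYPOTHESIS; NO table's letter is proved here (the literal's instance —
`symSiteWardM` packed — is the OWNER's C-g24-4); no definition, no `def … : Prop`, nothing cited, NO printed hypothesis, 0 sorry.  0∕4 row-D1 binders; (J1) ONE OPEN
ROW; (K) NOT closed; NOT D1, NEVER «G-an2-4 closed», NOT `BetaPertH`, NOT continuum, NOT Clay.

ABSOLUTE RULE (cell charter, verbatim): «No internally-minted statement may enter as a cited fact. Every hypothesis is either kernel-proved in
this package or a verbatim quotation of a PUBLISHED theorem with page reference. The manuscript(s) under audit are NOT citable for their own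
disputed steps — they are the thing under adjudication; programme-internal (2001/route/tribunal) claims are never citable.»

Unit `b2b-balaban-beta-d1-formalise-leaf-03` (gen 31), D1 formalisation swarm LEAF PROVER 03 (the (J1) chart-transport lineage), 2026-08-23.  Not in print; our
bookkeeping.  No existing file touched.
-/

noncomputable section

namespace Summit.QuantumFields.BalabanUV.Beta.SymCorrectorMixedSiteGauge

open Finset
open scoped BigOperators
open Literature.MathematicalPhysics.QuantumFieldTheory
open Literature.MathematicalPhysics.QuantumFieldTheory.Balaban1983to89
open Literature.MathematicalPhysics.QuantumFieldTheory.Balaban1983to89.Beta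
open B12Sec2to5 (l1 l1_nonneg)
open ExpKernelCalculus (MKer Decays comp)
open OneStepResolventKernel (Fib wsum)
open OneStepKernelFamily (colH vertexOfK)
open InterLevelTransport (cwsum cwsum_apply)
open SecondOrderResponse (colM vertexOfM mixOfK LocStencilFM)
open KernelWard (divV)
open AffineAveraging (Site box)
open AveragingContours (blk)
open Summit.QuantumFields.BalabanUV.Beta.TameKernelCalculus (Spr trK)
open Summit.QuantumFields.BalabanUV.Beta.ChartConjugation (conjV)
open Summit.QuantumFields.BalabanUV.Beta.BorderedHessian (diagK diagK_apply conjV_diagK_apply comp_diagK_left)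
open Summit.QuantumFields.BalabanUV.Beta.AveragingWardRootedStencils (legSite legInd legInd_apply)
open Summit.QuantumFields.BalabanUV.Beta.CompositeCorrectorLocality (blockSitesF mem_blockSitesF_of_blk_eq)
open Summit.QuantumFields.BalabanUV.Beta.SymCorrectorKernel (psiKS)
open Summit.QuantumFields.BalabanUV.Beta.SymCorrectorFace (faceWt faceWtSum faceWtSum_nonneg abs_faceWt_le faceSum slotPsiS)
open Summit.QuantumFields.BalabanUV.Beta.SymCorrectorFaceDiv (faceSum_eq_blockSum_divV blk_eq_of_mem_blockSitesF)
open Summit.QuantumFields.BalabanUV.Beta.SymCorrectorRest (mixOfK_conj_psiKS abs_mixed_slice_le)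
open Summit.QuantumFields.BalabanUV.Beta.SecondOrderRemainderTables (mixOfK_add_of_bdd)
open Summit.QuantumFields.BalabanUV.Beta.SymCorrectorFaceGauge (sum_blockSitesF_legInd sum_blockSitesF_ite_eq blockContact_term_eq_zero_of_not_mem)
open Summit.QuantumFields.BalabanUV.Beta.SymCorrectorMixedGauge (faceSumFM_apply)

variable {d : ℕ} {n : ℕ}

/-! ## §1 Letter-free bookkeeping -/

/-- [folklore] **THE BLOCK SUM OF THE LEFT LEG MULTIPLICATIONS IS THE BLOCK-LEFT MULTIPLICATION**:
`Σ_{u ∈ blockSitesF n Y} comp (diagK (legInd ϱ u)) M = comp (diagK (z b ↦ [blk n (legSite ϱ z b) = Y])) M` (entrywise; TT10 `sum_blockSitesF_legInd`). -/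
theorem sum_blockSitesF_comp_diagK_legInd (hn : 0 < n) (M : MKer (d + 1) (Fib d)) (ϱ Y : Site (d + 1)) :
    ∑ u ∈ blockSitesF n Y, comp (diagK (legInd ϱ u)) M = comp (diagK fun z b => if blk n (legSite ϱ z b) = Y then (1 : ℝ) else 0) M := by
  funext p q a c
  rw [Finset.sum_apply, Finset.sum_apply, Finset.sum_apply, Finset.sum_apply, comp_diagK_left]
  simp only [comp_diagK_left]
  rw [← Finset.sum_mul, sum_blockSitesF_legInd hn]

/-- [folklore] **THE BLOCK SUM OF THE ANCHOR INDICATORS**: `Σ_{u ∈ blockSitesF n Y} [u = A] • M = [blk n A = Y] • M` (TT10 `sum_blockSitesF_ite_eq`). -/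
theorem sum_blockSitesF_anchor_smul (hn : 0 < n) (M : MKer (d + 1) (Fib d)) (Y A : Site (d + 1)) :
    ∑ u ∈ blockSitesF n Y, (if u = A then (1 : ℝ) else 0) • M = (if blk n A = Y then (1 : ℝ) else 0) • M := by
  rw [← Finset.sum_smul]
  congr 1
  rw [← sum_blockSitesF_ite_eq hn Y A]
  exact Finset.sum_congr rfl fun u _ => by simp only [eq_comm]

/-- [folklore] **THE MULTIPLIER-COLUMN VERTEX OF A LEFT-MULTIPLIED FAMILY WITH A FIXED DIAGONAL** (any `K`, `n ≠ 0`; no summability — `tsum_mul_left`):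
`vertexOfM K n (ρ w ↦ comp (diagK g) (M ρ w)) ν y′ = comp (diagK g) (vertexOfM K n M ν y′)`. -/
theorem vertexOfM_comp_diagK_fixed [NeZero n] (K : MKer (d + 1) (Fib d)) (M : Fin (d + 1) → Site (d + 1) → MKer (d + 1) (Fib d))
    (g : Site (d + 1) → Fib d → ℝ) (ν : Fin (d + 1)) (y' : Site (d + 1)) :
    vertexOfM K n (fun ρ w => comp (diagK g) (M ρ w)) ν y' = comp (diagK g) (vertexOfM K n M ν y') := by
  funext p q a c
  rw [comp_diagK_left]
  simp only [vertexOfM, cwsum_apply, comp_diagK_left]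
  rw [Finset.mul_sum]
  refine Finset.sum_congr rfl fun ρ _ => ?_
  rw [← tsum_mul_left]
  refine tsum_congr fun w => ?_
  ring

/-- [folklore] **THE CHAIN-RULE VERTEX OF A BLOCK-LEFT FAMILY IS THE LEFT MULTIPLICATION BY THE DRESSED BLOCK SYMBOL** (any `K`, `X`, `ϱ`, coefficients `c`; no summability
hypothesis — each site series collapses to the block of the row leg's site):
`vertexOfK K n (α x ↦ comp (diagK (z b ↦ [blk n (legSite ϱ z b) = blk n x]·c α x)) X) μ y = comp (diagK (z b ↦ Σ_α Σ_{x ∈ blockSitesF n (blk n (legSite ϱ z b))} colH K n μ y α x·c α x)) X`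
— the LEFT twin of TT10 `vertexOfK_blockContact_eq_conjV`. -/
theorem vertexOfK_blockLeft_eq_comp (hn : 0 < n) (K X : MKer (d + 1) (Fib d)) (ϱ : Site (d + 1)) (c : Fin (d + 1) → Site (d + 1) → ℝ)
    (μ : Fin (d + 1)) (y : Site (d + 1)) :
    vertexOfK K n (fun α x => comp (diagK fun z b => if blk n (legSite ϱ z b) = blk n x then c α x else 0) X) μ y
      = comp (diagK fun z b => ∑ α : Fin (d + 1), ∑ x ∈ blockSitesF n (blk n (legSite ϱ z b)), colH K n μ y α x * c α x) X := by
  have hsupp := blockContact_term_eq_zero_of_not_mem hn K ϱ c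
  funext p q a e
  rw [comp_diagK_left]
  simp only [vertexOfK, OneStepResolventKernel.wsum, comp_diagK_left]
  rw [Finset.sum_mul]
  refine Finset.sum_congr rfl fun α _ => ?_
  have hs : ∀ x ∉ blockSitesF n (blk n (legSite ϱ p a)), colH K n μ y α x * ((if blk n (legSite ϱ p a) = blk n x then c α x else 0) * X p q a e) = 0 :=
    fun x hx => by rw [← mul_assoc, hsupp μ y α p a x hx, zero_mul]
  rw [tsum_eq_sum hs, Finset.sum_mul]
  refine Finset.sum_congr rfl fun x hx => ?_
  rw [if_pos (blk_eq_of_mem_blockSitesF hn hx).symm]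
  ring

/-- [folklore] **THE MIXED BI-VERTEX OF A BLOCK-LEFT FAMILY** (any `K`, `n ≠ 0`, multiplier table `M`, coefficients `c`):
`mixOfK K n (κ u ρ w ↦ comp (diagK (z b ↦ [blk n (legSite ϱ z b) = blk n u]·c κ u)) (M ρ w)) μ y ν y′ = comp (Θc μ y) (vertexOfM K n M ν y′)`,
`Θc μ y := diagK (z b ↦ Σ_α Σ_{x ∈ blockSitesF n (blk n (legSite ϱ z b))} colH K n μ y α x·c α x)`. -/
theorem mixOfK_blockLeft_eq [NeZero n] (hn : 0 < n) (K : MKer (d + 1) (Fib d)) (ϱ : Site (d + 1)) (M : Fin (d + 1) → Site (d + 1) → MKer (d + 1) (Fib d))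
    (c : Fin (d + 1) → Site (d + 1) → ℝ) (μ : Fin (d + 1)) (y : Site (d + 1)) (ν : Fin (d + 1)) (y' : Site (d + 1)) :
    mixOfK K n (fun κ u ρ w => comp (diagK fun z b => if blk n (legSite ϱ z b) = blk n u then c κ u else 0) (M ρ w)) μ y ν y'
      = comp (diagK fun z b => ∑ α : Fin (d + 1), ∑ x ∈ blockSitesF n (blk n (legSite ϱ z b)), colH K n μ y α x * c α x) (vertexOfM K n M ν y') := by
  unfold SecondOrderResponse.mixOfK
  have hin : (fun κ u => vertexOfM K n (fun ρ w => comp (diagK fun z b => if blk n (legSite ϱ z b) = blk n u then c κ u else 0) (M ρ w)) ν y')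
      = fun κ u => comp (diagK fun z b => if blk n (legSite ϱ z b) = blk n u then c κ u else 0) (vertexOfM K n M ν y') := by
    funext κ u
    exact vertexOfM_comp_diagK_fixed K M _ ν y'
  rw [hin]
  exact vertexOfK_blockLeft_eq_comp hn K (vertexOfM K n M ν y') ϱ c μ y

/-! ## §2 Under the site-law-shaped letter: the face sum, the face family, the slot transport of `M₂` -/

section Letter

variable (hn : 0 < n) (r : Fin (d + 1) → ℕ)
  {M₂ : Fin (d + 1) → Site (d + 1) → Fin (d + 1) → Site (d + 1) → MKer (d + 1) (Fib d)} {M : Fin (d + 1) → Site (d + 1) → MKer (d + 1) (Fib d)}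
  {ϱ : Site (d + 1)} {ξ' : ℝ}
  (hMs : ∀ ρ w u', divV (fun κ u => M₂ κ u ρ w) u'
    = ξ' • ((if u' = (n : ℤ) • w + ϱ then (1 : ℝ) else 0) • M ρ w - comp (diagK (legInd ϱ u')) (M ρ w)))
include hn hMs

/-- [folklore] **THE FACE SUM OF THE FIELD SLOT UNDER THE SITE-LAW LETTER = ANCHOR − BLOCK-LEFT**:
`faceSum n (κ u ↦ M₂ κ u ρ w) Y = ξ′ • ([blk n (n•w + ϱ) = Y] • M ρ w − comp (diagK [blk n (legSite ϱ · ·) = Y]) (M ρ w))` (TT7 `faceSum_eq_blockSum_divV` + §1). -/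
theorem faceSum_eq_of_siteLetter (ρ : Fin (d + 1)) (w Y : Site (d + 1)) :
    faceSum n (fun κ u => M₂ κ u ρ w) Y
      = ξ' • ((if blk n ((n : ℤ) • w + ϱ) = Y then (1 : ℝ) else 0) • M ρ w
          - comp (diagK fun z b => if blk n (legSite ϱ z b) = Y then (1 : ℝ) else 0) (M ρ w)) := by
  rw [faceSum_eq_blockSum_divV hn _ Y, Finset.sum_congr rfl fun u _ => hMs ρ w u, ← Finset.smul_sum, Finset.sum_sub_distrib,
    sum_blockSitesF_anchor_smul hn, sum_blockSitesF_comp_diagK_legInd hn]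

/-- [folklore] **THE MIXED FACE PIECE UNDER THE SITE-LAW LETTER**: `faceWt r n κ u • (faceSum n M₂ (blk n u)) ρ w
= (if blk n (n•w + ϱ) = blk n u then ξ′·faceWt r n κ u else 0) • M ρ w − comp (diagK (z b ↦ [blk n (legSite ϱ z b) = blk n u]·(ξ′·faceWt r n κ u))) (M ρ w)`. -/
theorem mixedFace_eq_of_siteLetter (κ : Fin (d + 1)) (u : Site (d + 1)) (ρ : Fin (d + 1)) (w : Site (d + 1)) :
    faceWt r n κ u • faceSum n M₂ (blk n u) ρ w
      = (if blk n ((n : ℤ) • w + ϱ) = blk n u then ξ' * faceWt r n κ u else 0) • M ρ w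
        - comp (diagK fun z b => if blk n (legSite ϱ z b) = blk n u then ξ' * faceWt r n κ u else 0) (M ρ w) := by
  rw [faceSumFM_apply, faceSum_eq_of_siteLetter hn hMs ρ w (blk n u)]
  funext p q a c
  simp only [Pi.smul_apply, Pi.sub_apply, smul_eq_mul, comp_diagK_left]
  split_ifs <;> ring

/-- [folklore] **THE SLOT-TRANSPORTED FIELD–MULTIPLIER TABLE UNDER THE SITE-LAW LETTER**, as a family: `slotPsiS r n M₂ = κ u ρ w ↦ M₂ κ u ρ w + (anchor • M ρ w − block-left (M ρ w))`. -/
theorem slotPsiS_FM_eq_of_siteLetter :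
    slotPsiS r n M₂ = fun κ u ρ w => M₂ κ u ρ w
      + ((if blk n ((n : ℤ) • w + ϱ) = blk n u then ξ' * faceWt r n κ u else 0) • M ρ w
        - comp (diagK fun z b => if blk n (legSite ϱ z b) = blk n u then ξ' * faceWt r n κ u else 0) (M ρ w)) := by
  funext κ u ρ w
  rw [← mixedFace_eq_of_siteLetter hn r hMs κ u ρ w]
  rfl

end Letter

/-! ## §3 Assembled: the transported mixed word = raw word + ANCHOR word − LEFT word -/

section Assembled

variable [NeZero n] (hn : 0 < n) (r : Fin (d + 1) → ℕ) {K : MKer (d + 1) (Fib d)} (hK : Spr K)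
  {M₂ : Fin (d + 1) → Site (d + 1) → Fin (d + 1) → Site (d + 1) → MKer (d + 1) (Fib d)} {C₂ δ₂ : ℝ} (hM₂ : LocStencilFM n M₂ C₂ δ₂) (hδ₂ : 0 < δ₂)
  {M : Fin (d + 1) → Site (d + 1) → MKer (d + 1) (Fib d)} {BM : ℝ} (hMb : ∀ ρ w p q a e, |M ρ w p q a e| ≤ BM)
  {ϱ : Site (d + 1)} {ξ' : ℝ}
  (hMs : ∀ ρ w u', divV (fun κ u => M₂ κ u ρ w) u'
    = ξ' • ((if u' = (n : ℤ) • w + ϱ then (1 : ℝ) else 0) • M ρ w - comp (diagK (legInd ϱ u')) (M ρ w)))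
include hn hK hM₂ hδ₂ hMb hMs

/-- [folklore] **THE MIXED BI-VERTEX OF THE SLOT-TRANSPORTED TABLE UNDER THE SITE-LAW LETTER, ASSEMBLED**: for a spread `K`, a local field–multiplier table, an entrywise
bounded multiplier table and the letter `hMs`,
`mixOfK K n (slotPsiS r n M₂) μ y ν y′ = mixOfK K n M₂ μ y ν y′ + mixOfK K n A μ y ν y′ − comp (Θ′ μ y) (vertexOfM K n M ν y′)`,
`A κ u ρ w := (if blk n (n•w + ϱ) = blk n u then ξ′·faceWt r n κ u else 0) • M ρ w`, `Θ′ μ y := diagK (z b ↦ Σ_α Σ_{x ∈ blockSitesF n (blk n (legSite ϱ z b))} colH K n μ y α x·(ξ′·faceWt r n α x))`. -/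
theorem mixOfK_slotPsiS_eq_of_siteLetter (μ : Fin (d + 1)) (y : Site (d + 1)) (ν : Fin (d + 1)) (y' : Site (d + 1)) :
    mixOfK K n (slotPsiS r n M₂) μ y ν y'
      = mixOfK K n M₂ μ y ν y'
        + mixOfK K n (fun κ u ρ w => (if blk n ((n : ℤ) • w + ϱ) = blk n u then ξ' * faceWt r n κ u else 0) • M ρ w) μ y ν y'
        - comp (diagK fun z b => ∑ α : Fin (d + 1), ∑ x ∈ blockSitesF n (blk n (legSite ϱ z b)), colH K n μ y α x * (ξ' * faceWt r n α x))
            (vertexOfM K n M ν y') := by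
  obtain ⟨CK, δK, hδK, hKd⟩ := hK
  have hKex : ∃ δ C : ℝ, 0 < δ ∧ 0 ≤ C ∧ Decays K C δ := ⟨δK, CK, hδK, hKd.nonneg (Sum.inl 0), hKd⟩
  have hBM : 0 ≤ BM := (abs_nonneg _).trans (hMb 0 0 0 0 (Sum.inl 0) (Sum.inl 0))
  -- entrywise bounds of the three pieces
  have b1 : ∀ κ u ρ w p q a e, |M₂ κ u ρ w p q a e| ≤ C₂ := fun κ u ρ w p q a e => abs_mixed_slice_le hM₂ hδ₂.le κ u ρ w p q a e
  have bc : ∀ (κ : Fin (d + 1)) (u : Site (d + 1)) (P : Prop) [Decidable P], |(if P then ξ' * faceWt r n κ u else 0)| ≤ |ξ'| * faceWtSum r n := by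
    intro κ u P _
    split_ifs
    · rw [abs_mul]; exact mul_le_mul_of_nonneg_left (abs_faceWt_le hn r κ u) (abs_nonneg ξ')
    · rw [abs_zero]; exact mul_nonneg (abs_nonneg ξ') (faceWtSum_nonneg r n)
  have b2 : ∀ (κ : Fin (d + 1)) (u : Site (d + 1)) (ρ : Fin (d + 1)) (w p q : Site (d + 1)) (a e : Fib d),
      |((if blk n ((n : ℤ) • w + ϱ) = blk n u then ξ' * faceWt r n κ u else 0) • M ρ w) p q a e| ≤ |ξ'| * faceWtSum r n * BM := by
    intro κ u ρ w p q a e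
    rw [Pi.smul_apply, Pi.smul_apply, Pi.smul_apply, Pi.smul_apply, smul_eq_mul, abs_mul]
    exact mul_le_mul (bc κ u _) (hMb ρ w p q a e) (abs_nonneg _) (mul_nonneg (abs_nonneg _) (faceWtSum_nonneg r n))
  have b3 : ∀ (κ : Fin (d + 1)) (u : Site (d + 1)) (ρ : Fin (d + 1)) (w p q : Site (d + 1)) (a e : Fib d),
      |(-comp (diagK fun z b => if blk n (legSite ϱ z b) = blk n u then ξ' * faceWt r n κ u else 0) (M ρ w)) p q a e| ≤ |ξ'| * faceWtSum r n * BM := by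
    intro κ u ρ w p q a e
    rw [Pi.neg_apply, Pi.neg_apply, Pi.neg_apply, Pi.neg_apply, abs_neg, comp_diagK_left, abs_mul]
    exact mul_le_mul (bc κ u _) (hMb ρ w p q a e) (abs_nonneg _) (mul_nonneg (abs_nonneg _) (faceWtSum_nonneg r n))
  have b23 : ∀ (κ : Fin (d + 1)) (u : Site (d + 1)) (ρ : Fin (d + 1)) (w p q : Site (d + 1)) (a e : Fib d),
      |(((if blk n ((n : ℤ) • w + ϱ) = blk n u then ξ' * faceWt r n κ u else 0) • M ρ w
          + -comp (diagK fun z b => if blk n (legSite ϱ z b) = blk n u then ξ' * faceWt r n κ u else 0) (M ρ w))) p q a e|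
        ≤ |ξ'| * faceWtSum r n * BM + |ξ'| * faceWtSum r n * BM := by
    intro κ u ρ w p q a e
    rw [Pi.add_apply, Pi.add_apply, Pi.add_apply, Pi.add_apply]
    exact (abs_add_le _ _).trans (add_le_add (b2 κ u ρ w p q a e) (b3 κ u ρ w p q a e))
  rw [slotPsiS_FM_eq_of_siteLetter hn r hMs]
  have esub : (fun κ u ρ w => M₂ κ u ρ w
        + ((if blk n ((n : ℤ) • w + ϱ) = blk n u then ξ' * faceWt r n κ u else 0) • M ρ w
          - comp (diagK fun z b => if blk n (legSite ϱ z b) = blk n u then ξ' * faceWt r n κ u else 0) (M ρ w)))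
      = fun κ u ρ w => M₂ κ u ρ w
        + ((if blk n ((n : ℤ) • w + ϱ) = blk n u then ξ' * faceWt r n κ u else 0) • M ρ w
          + -comp (diagK fun z b => if blk n (legSite ϱ z b) = blk n u then ξ' * faceWt r n κ u else 0) (M ρ w)) := by
    funext κ u ρ w; rw [sub_eq_add_neg]
  rw [esub, mixOfK_add_of_bdd (N := n) hKex (fun κ u ρ w p q a e => b1 κ u ρ w p q a e) (fun κ u ρ w p q a e => b23 κ u ρ w p q a e) μ y ν y',
    mixOfK_add_of_bdd (N := n) hKex (fun κ u ρ w p q a e => b2 κ u ρ w p q a e) (fun κ u ρ w p q a e => b3 κ u ρ w p q a e) μ y ν y']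
  -- the LEFT piece: `mixOfK` of the negated block-left family
  have eneg : (fun κ u ρ w => -comp (diagK fun z b => if blk n (legSite ϱ z b) = blk n u then ξ' * faceWt r n κ u else 0) (M ρ w))
      = fun κ u ρ w => comp (diagK fun z b => if blk n (legSite ϱ z b) = blk n u then -(ξ' * faceWt r n κ u) else 0) (M ρ w) := by
    funext κ u ρ w p q a e
    rw [Pi.neg_apply, Pi.neg_apply, Pi.neg_apply, Pi.neg_apply, comp_diagK_left, comp_diagK_left]
    split_ifs <;> ring
  rw [eneg, mixOfK_blockLeft_eq hn K ϱ M (fun κ u => -(ξ' * faceWt r n κ u)) μ y ν y']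
  have esym : (diagK fun z b => ∑ α : Fin (d + 1), ∑ x ∈ blockSitesF n (blk n (legSite ϱ z b)), colH K n μ y α x * -(ξ' * faceWt r n α x))
      = -(diagK fun z b => ∑ α : Fin (d + 1), ∑ x ∈ blockSitesF n (blk n (legSite ϱ z b)), colH K n μ y α x * (ξ' * faceWt r n α x)) := by
    funext p q a e
    rw [Pi.neg_apply, Pi.neg_apply, Pi.neg_apply, Pi.neg_apply, diagK_apply, diagK_apply]
    split_ifs
    · rw [← Finset.sum_neg_distrib]
      refine Finset.sum_congr rfl fun α _ => ?_
      rw [← Finset.sum_neg_distrib]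
      exact Finset.sum_congr rfl fun x _ => by ring
    · rw [neg_zero]
  rw [esym, TameKernelCalculus.comp_neg_left]
  abel

variable {r} (hr : r ∈ box (d + 1) n)
include hr

/-- [folklore] **THE MIXED WORD OF THE CHART TRANSPORT UNDER THE SITE-LAW LETTER**: for an in-block root offset `r`, `Ψ̂ := psiKS r n`,
`mixOfK (Ψ̂∘K∘Ψ̂ᵀ) n M₂ μ y ν y′ = mixOfK K n M₂ μ y ν y′ + mixOfK K n A μ y ν y′ − comp (Θ′ μ y) (vertexOfM K n M ν y′)` (TT6 `mixOfK_conj_psiKS` + the assembled identity). -/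
theorem mixOfK_conj_psiKS_eq_of_siteLetter (μ : Fin (d + 1)) (y : Site (d + 1)) (ν : Fin (d + 1)) (y' : Site (d + 1)) :
    mixOfK (comp (comp (psiKS r n) K) (trK (psiKS r n))) n M₂ μ y ν y'
      = mixOfK K n M₂ μ y ν y'
        + mixOfK K n (fun κ u ρ w => (if blk n ((n : ℤ) • w + ϱ) = blk n u then ξ' * faceWt r n κ u else 0) • M ρ w) μ y ν y'
        - comp (diagK fun z b => ∑ α : Fin (d + 1), ∑ x ∈ blockSitesF n (blk n (legSite ϱ z b)), colH K n μ y α x * (ξ' * faceWt r n α x))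
            (vertexOfM K n M ν y') := by
  rw [mixOfK_conj_psiKS hn hr hK hM₂ hδ₂ μ y ν y']
  exact mixOfK_slotPsiS_eq_of_siteLetter hn r hK hM₂ hδ₂ hMb hMs μ y ν y'

end Assembled

end Summit.QuantumFields.BalabanUV.Beta.SymCorrectorMixedSiteGauge

end
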